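import Summits.QuantumAdvantage.QuantumAdvantage.Theorems.CubicForrelationNearExactIsExactTwelveTypeO934Wild
import Summits.QuantumAdvantage.QuantumAdvantage.Theorems.CubicForrelationNearExactIsExactFlatL1

/-!
# Crux `CubicForrelation.NearExactIsExact` (stmt-QuantumAdvantage-14043) — n = 12: the counting ENGINE killing the (type O, base 960) × (level ≥ 6)
  configuration at `Φ = 932/1024` (abstract form)

Certificate seat `b2b-cforr-cert` (gen 18).  HONEST FRAMING: an elementary lemma (standard axioms) about integer functions on a 9-dimensional subspace
of `𝔽₂¹²`; it is the last step of `…TwelveT1Dead` (no T1 pair), finite-slice bookkeeping, NOT summit progress.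

`t1e_engine`.  Data: `V₀ ≤ 𝔽₂¹²` a subspace with `512` elements; a sign pattern `σ = ±1` on `V₀` whose transform `T = (σ·1_{V₀})^∧` is supported
on `≤ 32` points (this is what (H3)/(H4) give via `fl1_flat_supp`); an integer function `t ≡ σ (mod 4)` on `V₀` with `t(0) = 15s` (`s = ±1`),
`Σ_{V₀} t² ≤ 960`, and `0 ≤ s·Σ_{z∈V₀} t(z)(−1)^{z·x} ≤ 64` for every `x` (in the application `t = s·Ê/64` on `V₀ = V₉` and the middle sum is
`8·#(E ∩ (x ⊕ V₀^⊥))`).  Then: contradiction.  Proof: `t = σ + 4b` with `t² ≥ 1 + 8|b|`, so `Σ|b| ≤ 56`; `T(x) = Σ t(−1)^{zx} − 4Σ b(−1)^{zx}`, hence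
`−224 ≤ s·T(x) ≤ 288`; `Σ_x T(x) = 4096·σ(0) = −4096·s` (`σ(0) ≡ 15s (mod 4)`), `Σ_x T(x)² = 4096·512` (Parseval); on the support
`(sT + 224)(288 − sT) ≥ 0` gives `T² ≤ 64·sT + 64512`, and summing over `≤ 32` points: `2^21 ≤ −262144 + 32·64512 = 1802240` — false.

References: R. O'Donnell (2014) §3.3.  Everything below is proved from Mathlib and the tree; axioms are the standard three.
-/

set_option linter.dupNamespace false -- D-0017: single-problem summit ⇒ `QuantumAdvantage.QuantumAdvantage` by design

noncomputable section

namespace Summit.QuantumAdvantage.QuantumAdvantage.Theorems.CubicForrelation.NearExactIsExact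

open Finset
open Literature.Computability.QuantumComplexity
open Literature.Computability.QuantumComplexity.BuzetChailloux (bxor zeroVec)
open Literature.Computability.QuantumComplexity.DerivativeWalsh (W)

/-- **The T1 counting engine** (see the module docstring).  NOT summit progress. [this work] -/
theorem t1e_engine (V₀ : Finset (Fin (6 + 6) → Bool)) (h0 : zeroVec ∈ V₀) (hcardV : #V₀ = 512)
    (σ : (Fin (6 + 6) → Bool) → ℤ) (hσ : ∀ z ∈ V₀, σ z = 1 ∨ σ z = -1)
    (hsupp : #(univ.filter fun x : Fin (6 + 6) → Bool => W (fun z => if z ∈ V₀ then (σ z : ℝ) else 0) x ≠ 0) ≤ 32)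
    (s : ℤ) (hs : s = 1 ∨ s = -1) (t : (Fin (6 + 6) → Bool) → ℤ) (hmod : ∀ z ∈ V₀, (4 : ℤ) ∣ t z - σ z)
    (ht0 : t zeroVec = 15 * s) (henergy : ∑ z ∈ V₀, t z ^ 2 ≤ 960)
    (hpos : ∀ x, 0 ≤ (s : ℝ) * ∑ z ∈ V₀, (t z : ℝ) * twist z x)
    (hle64 : ∀ x, (s : ℝ) * ∑ z ∈ V₀, (t z : ℝ) * twist z x ≤ 64) : False := by
  classical
  set A : (Fin (6 + 6) → Bool) → ℝ := fun z => if z ∈ V₀ then (σ z : ℝ) else 0 with hA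
  -- `t = σ + 4b` with `t² ≥ 1 + 8|b|`, so `Σ |b| ≤ 56`
  have habs : ∀ b : ℤ, |b| ≤ b * b := by
    intro b
    rcases le_or_gt 0 b with h | h
    · rw [abs_of_nonneg h]
      rcases h.eq_or_lt with h1 | h1
      · rw [← h1]; norm_num
      · nlinarith
    · rw [abs_of_neg h]; nlinarith
  have hb : ∀ z ∈ V₀, ∃ b : ℤ, t z = σ z + 4 * b ∧ 1 + 8 * |b| ≤ t z ^ 2 := by
    intro z hz
    obtain ⟨b, hb⟩ := hmod z hz
    refine ⟨b, by linarith, ?_⟩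
    have ht : t z = σ z + 4 * b := by linarith
    rw [ht]
    rcases hσ z hz with h | h <;> rw [h] <;> nlinarith [habs b, le_abs_self b, neg_abs_le b]
  choose! b hbt hbsq using hb
  have hsumb : ∑ z ∈ V₀, |b z| ≤ 56 := by
    have h1 : ∑ z ∈ V₀, (1 + 8 * |b z|) ≤ ∑ z ∈ V₀, t z ^ 2 := sum_le_sum fun z hz => hbsq z hz
    rw [sum_add_distrib, sum_const, hcardV, ← mul_sum] at h1
    norm_num at h1
    linarith
  -- `T = Σ t χ − 4 Σ b χ`
  have hT : ∀ x, W A x = ∑ z ∈ V₀, (t z : ℝ) * twist z x - 4 * ∑ z ∈ V₀, (b z : ℝ) * twist z x := by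
    intro x
    unfold W
    rw [sum_congr rfl fun z _ => by rw [ite_mul, zero_mul], sum_ite_mem, univ_inter, mul_sum, ← sum_sub_distrib]
    refine sum_congr rfl fun z hz => ?_
    have h' : ((t z : ℤ) : ℝ) = σ z + 4 * b z := by exact_mod_cast hbt z hz
    rw [h']; ring
  have hbtw : ∀ x, |∑ z ∈ V₀, (b z : ℝ) * twist z x| ≤ 56 := by
    intro x
    have hcast : ((∑ z ∈ V₀, |b z| : ℤ) : ℝ) ≤ 56 := by exact_mod_cast hsumb
    push_cast at hcast
    calc |∑ z ∈ V₀, (b z : ℝ) * twist z x| ≤ ∑ z ∈ V₀, |(b z : ℝ) * twist z x| := abs_sum_le_sum_abs _ _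
      _ = ∑ z ∈ V₀, |(b z : ℝ)| := sum_congr rfl fun z _ => by rw [abs_mul, abs_twist, mul_one]
      _ ≤ 56 := hcast
  have hsR : (s : ℝ) = 1 ∨ (s : ℝ) = -1 := by rcases hs with h | h <;> simp [h]
  have hlow : ∀ x, -224 ≤ (s : ℝ) * W A x := by
    intro x
    have h1 := hpos x
    have h2 := hbtw x
    rw [abs_le] at h2
    rw [hT x]
    rcases hsR with h | h <;> rw [h] at h1 ⊢ <;> linarith [h2.1, h2.2]
  have hhigh : ∀ x, (s : ℝ) * W A x ≤ 288 := by
    intro x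
    have h1 := hle64 x
    have h2 := hbtw x
    rw [abs_le] at h2
    rw [hT x]
    rcases hsR with h | h <;> rw [h] at h1 ⊢ <;> linarith [h2.1, h2.2]
  -- `Σ_x T(x) = 4096 σ(0) = −4096 s`
  have hσ0 : σ zeroVec = -s := by
    obtain ⟨c, hc⟩ := hmod zeroVec h0
    rw [ht0] at hc
    rcases hσ zeroVec h0 with h | h <;> rcases hs with h' | h' <;> rw [h, h'] at hc ⊢ <;> omega
  have hsumT : ∑ x, W A x = -4096 * (s : ℝ) := by
    have e1 : ∑ x, W A x = ∑ z, A z * ∑ x : Fin (6 + 6) → Bool, twist x z := by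
      unfold W
      rw [sum_comm]
      exact sum_congr rfl fun z _ => by rw [mul_sum]; exact sum_congr rfl fun x _ => by rw [twist_comm]
    rw [e1, sum_congr rfl fun z _ => by rw [tz_sum_twist_left]]
    rw [sum_eq_single_of_mem (fun _ : Fin (6 + 6) => false) (mem_univ _) fun z _ hz => by rw [if_neg hz, mul_zero]]
    rw [if_pos rfl]
    have hA0 : A (fun _ => false) = (σ zeroVec : ℝ) := by
      simp only [A]; rw [if_pos (show ((fun _ => false) : Fin (6 + 6) → Bool) ∈ V₀ from h0)]; rfl
    rw [hA0, hσ0]; push_cast; norm_num; ring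
  -- Parseval
  have hA1 : ∀ z ∈ V₀, A z = 1 ∨ A z = -1 := by
    intro z hz; simp only [A, if_pos hz]; rcases hσ z hz with h | h <;> rw [h] <;> norm_num
  have hA0' : ∀ z, z ∉ V₀ → A z = 0 := fun z hz => by simp only [A, if_neg hz]
  have hpars : ∑ x, W A x ^ 2 = 2097152 := by
    rw [fp_parseval_pm A V₀ hA1 hA0', hcardV]; norm_num
  -- restrict to the support
  set Y := univ.filter (fun x : Fin (6 + 6) → Bool => W A x ≠ 0) with hY
  have hsumY : ∑ x ∈ Y, W A x = ∑ x, W A x := sum_filter_ne_zero _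
  have hsqY : ∑ x ∈ Y, W A x ^ 2 = ∑ x, W A x ^ 2 := by
    rw [hY, sum_filter]
    exact sum_congr rfl fun x _ => by split_ifs with h <;> [rfl; (rw [not_not.1 h]; ring)]
  have hkey : ∀ x, W A x ^ 2 ≤ 64 * ((s : ℝ) * W A x) + 64512 := by
    intro x
    have h1 := hlow x
    have h2 := hhigh x
    have hs2 : ((s : ℝ) * W A x) ^ 2 = W A x ^ 2 := by rcases hsR with h | h <;> rw [h] <;> ring
    nlinarith [mul_nonneg (sub_nonneg.2 h2) (by linarith : (0 : ℝ) ≤ (s : ℝ) * W A x + 224)]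
  have hYle : ∑ x ∈ Y, W A x ^ 2 ≤ 64 * ((s : ℝ) * ∑ x ∈ Y, W A x) + 64512 * #Y := by
    calc ∑ x ∈ Y, W A x ^ 2 ≤ ∑ x ∈ Y, (64 * ((s : ℝ) * W A x) + 64512) := sum_le_sum fun x _ => hkey x
      _ = 64 * ((s : ℝ) * ∑ x ∈ Y, W A x) + 64512 * #Y := by
        rw [sum_add_distrib, sum_const, nsmul_eq_mul, ← mul_sum, ← mul_sum]; ring
  rw [hsqY, hpars, hsumY, hsumT] at hYle
  have hYcard : (#Y : ℝ) ≤ 32 := by exact_mod_cast hsupp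
  have hs2 : (s : ℝ) * (s : ℝ) = 1 := by rcases hsR with h | h <;> rw [h] <;> norm_num
  nlinarith

end Summit.QuantumAdvantage.QuantumAdvantage.Theorems.CubicForrelation.NearExactIsExact

end
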